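import Mathlib
import HarnessLib
import Summits.NavierStokesRegularity.NavierStokesRegularity.Theorems.PoloidalWindowDoorLrcModEntireAxisKinematics4
import Summits.NavierStokesRegularity.NavierStokesRegularity.Theorems.PoloidalWindowDoorLrcModEntireAxisKinematics5
import Summits.NavierStokesRegularity.NavierStokesRegularity.Theorems.PoloidalWindowDoorLrcModEntireAxisKinematics7

/-!
# Route `PoloidalWindowDoor`, item `LrcModEntire` (stmt-NavierStokesRegularity-20428) — AXIS KINEMATICS XI: PER-PLANE versions of
# IV (`α·U_wU_a = 0 ⇒ α = 0`) and V (a Hill-type quadratic `v₂ = kρ² + m` on a planar open piece is excluded in the class)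

Cell ns-regularity-ideate, seat ns-poloidal-K2-p3 gen 5 (LEAD of item 20428; file landed `--supports stmt-NavierStokesRegularity-20428` as a
helper).  Plan steps VIII-b and V-plane of AXIS-NOTE.  Both reductions use the vertical projection onto the plane `{y₂ = z₀}`,
`π y = y + (z₀ − y₂) e₂` (continuous, affine, real-analytic; `π y = y` on the plane; `(π y)₀ = y₀`, `(π y)₁ = y₁`): a hypothesis known only
on `O ∩ {y₂ = z₀}` becomes a hypothesis on the OPEN set `π⁻¹ O ⊆ ℝ³` for the function `f ∘ π`, to which the `ℝ³` versions
(`…AxisKinematics4.eq_zero_of_mul_hdot_eq_zero`, `…AxisKinematics5`) apply.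

* `eq_zero_of_mul_hdot_eq_zero_plane` — `α U_wU_a = 0` on `O ∩ {y₂ = z₀}`, `a_h ≠ 0`, `α` continuous at those points ⇒ `α = 0` there.
* `apply_two_eq_quadratic_of_eqOn_plane`, `quadratic_coeff_eq_zero_of_eqOn_plane`, `horizontalGradient_eq_zero_of_quadratic_plane` —
  CLASS: if `v₂(s,y) = k((y₀−c₀)² + (y₁−c₁)²) + m` at the points of height `z₀` of an open `U` meeting that plane, then `k = 0`,
  `v₂(s,·) ≡ m` on the whole plane `{y₂ = z₀}`, and `∂₀v₂ = ∂₁v₂ = 0` at every point of that plane.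

WHAT THIS IS NOT: not a claim about Navier–Stokes regularity — calculus / identity-theorem plumbing (bears_on LADDER-NS N0 via item 20428).
-/

noncomputable section

-- the summit and its single sub-problem share the name (CONVENTIONS §1), as in every Theorems file
set_option linter.dupNamespace false

namespace Summit.NavierStokesRegularity.NavierStokesRegularity.Theorems.PoloidalWindowDoorLrcModEntireAxisKinematics11

open Set Function Filter Topology Metric
open scoped RealInnerProductSpace InnerProductSpace
open Literature.Analysis Literature.Analysis.FluidPDE
open Summit.NavierStokesRegularity.NavierStokesRegularity.Theorems.LocalSineTubeDoorProfileAlignedWindowRigidityAncient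
open Summit.NavierStokesRegularity.NavierStokesRegularity.Theorems.PoloidalWindowDoorPoloidalWindowRigiditySymmetryGerms
open Summit.NavierStokesRegularity.NavierStokesRegularity.Theorems.PoloidalWindowDoorLrcModEntireAxisKinematics
open Summit.NavierStokesRegularity.NavierStokesRegularity.Theorems.PoloidalWindowDoorLrcModEntireAxisKinematics4
open Summit.NavierStokesRegularity.NavierStokesRegularity.Theorems.PoloidalWindowDoorLrcModEntireAxisKinematics5
open Summit.NavierStokesRegularity.NavierStokesRegularity.Theorems.PoloidalWindowDoorLrcModEntireAxisKinematics7

/-! ### The vertical projection `π y = y + (z₀ − y₂) e₂` -/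

/-- Coordinates of the projection: `(π y)₀ = y₀`, `(π y)₁ = y₁`, `(π y)₂ = z₀`. -/
theorem planeProj_apply (y : EuclideanSpace ℝ (Fin 3)) (z₀ : ℝ) :
    (y + (z₀ - y 2) • EuclideanSpace.single (2 : Fin 3) (1 : ℝ)) 0 = y 0 ∧
      (y + (z₀ - y 2) • EuclideanSpace.single (2 : Fin 3) (1 : ℝ)) 1 = y 1 ∧
      (y + (z₀ - y 2) • EuclideanSpace.single (2 : Fin 3) (1 : ℝ)) 2 = z₀ := by
  refine ⟨by simp, by simp, by simp⟩

/-- On the plane the projection is the identity. -/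
theorem planeProj_eq_self {y : EuclideanSpace ℝ (Fin 3)} {z₀ : ℝ} (h : y 2 = z₀) :
    y + (z₀ - y 2) • EuclideanSpace.single (2 : Fin 3) (1 : ℝ) = y := by
  rw [h, sub_self, zero_smul, add_zero]

/-- The projection is continuous. -/
theorem continuous_planeProj (z₀ : ℝ) :
    Continuous fun y : EuclideanSpace ℝ (Fin 3) => y + (z₀ - y 2) • EuclideanSpace.single (2 : Fin 3) (1 : ℝ) := by
  have h2 : Continuous fun y : EuclideanSpace ℝ (Fin 3) => y 2 := (EuclideanSpace.proj (2 : Fin 3)).continuous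
  fun_prop

/-- The projection is real-analytic. -/
theorem analyticOnNhd_planeProj (z₀ : ℝ) :
    AnalyticOnNhd ℝ (fun y : EuclideanSpace ℝ (Fin 3) => y + (z₀ - y 2) • EuclideanSpace.single (2 : Fin 3) (1 : ℝ)) univ := by
  intro y _
  have h2 : AnalyticAt ℝ (fun y : EuclideanSpace ℝ (Fin 3) => y 2) y :=
    (EuclideanSpace.proj (2 : Fin 3) : EuclideanSpace ℝ (Fin 3) →L[ℝ] ℝ).analyticAt y
  exact analyticAt_id.add ((analyticAt_const.sub h2).smul analyticAt_const)

/-! ### IV per plane -/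

/-- **`α · U_wU_a = 0` on a planar open piece forces `α = 0` there** (`a_h ≠ 0`).  Per-plane version of
`…AxisKinematics4.eq_zero_of_mul_hdot_eq_zero`: the hypothesis and the conclusion live on `O ∩ {y₂ = z₀}` (`O` open in `ℝ³`), and `α` is
only required to be continuous (as a function on `ℝ³`) at those points. -/
theorem eq_zero_of_mul_hdot_eq_zero_plane {α : EuclideanSpace ℝ (Fin 3) → ℝ} {c a : EuclideanSpace ℝ (Fin 3)}
    {O : Set (EuclideanSpace ℝ (Fin 3))} (hO : IsOpen O) {z₀ : ℝ} (hαc : ∀ y ∈ O, y 2 = z₀ → ContinuousAt α y)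
    (ha : a 0 ≠ 0 ∨ a 1 ≠ 0)
    (h : ∀ y ∈ O, y 2 = z₀ →
      α y * (((y 0 - c 0) * (-a 1) + (y 1 - c 1) * a 0) * ((y 0 - c 0) * a 0 + (y 1 - c 1) * a 1)) = 0)
    {y : EuclideanSpace ℝ (Fin 3)} (hy : y ∈ O) (hyz : y 2 = z₀) : α y = 0 := by
  set π : EuclideanSpace ℝ (Fin 3) → EuclideanSpace ℝ (Fin 3) :=
    fun y' => y' + (z₀ - y' 2) • EuclideanSpace.single (2 : Fin 3) (1 : ℝ) with hπ
  have hπc : Continuous π := continuous_planeProj z₀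
  have hO' : IsOpen (π ⁻¹' O) := hO.preimage hπc
  have hαc' : ContinuousOn (α ∘ π) (π ⁻¹' O) := fun y' hy' =>
    ((hαc (π y') hy' (planeProj_apply y' z₀).2.2).comp hπc.continuousAt).continuousWithinAt
  have h' : ∀ y' ∈ π ⁻¹' O,
      (α ∘ π) y' * (((y' 0 - c 0) * (-a 1) + (y' 1 - c 1) * a 0) * ((y' 0 - c 0) * a 0 + (y' 1 - c 1) * a 1)) = 0 := by
    intro y' hy'
    have := h (π y') hy' (planeProj_apply y' z₀).2.2
    rw [(planeProj_apply y' z₀).1, (planeProj_apply y' z₀).2.1] at this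
    exact this
  have hyO' : y ∈ π ⁻¹' O := by
    show π y ∈ O
    rw [hπ]; dsimp only; rw [planeProj_eq_self hyz]; exact hy
  have := eq_zero_of_mul_hdot_eq_zero hO' hαc' ha h' hyO'
  simpa [hπ, planeProj_eq_self hyz] using this

/-! ### V per plane (class form) -/

section Class

variable {C : ℝ} {v : ℝ → EuclideanSpace ℝ (Fin 3) → EuclideanSpace ℝ (Fin 3)}

/-- **Identity theorem along a plane.**  If the vertical velocity of the slice `s < 0` of a profile of the route's Type-I class agrees with
`k((y₀−c₀)² + (y₁−c₁)²) + m` at the points of height `z₀` of an open `U` meeting that plane, it agrees with it on the whole plane. -/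
theorem apply_two_eq_quadratic_of_eqOn_plane (hrate : HasTypeITimeDecay C v)
    (hcont : ContinuousOn (uncurry v) (Iio (0 : ℝ) ×ˢ univ))
    (hmild : ∀ s t : ℝ, s < t → t < 0 → ∀ x,
      v t x = UnboundedOperators.heatExtension (v s) (t - s) x - oseenDuhamel 1 s v v t x)
    {s : ℝ} (hs : s < 0) {k m : ℝ} {c : EuclideanSpace ℝ (Fin 3)} {z₀ : ℝ} {U : Set (EuclideanSpace ℝ (Fin 3))} (hU : IsOpen U)
    (hne : ∃ y ∈ U, y 2 = z₀) (h : ∀ y ∈ U, y 2 = z₀ → v s y 2 = k * ((y 0 - c 0) ^ 2 + (y 1 - c 1) ^ 2) + m)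
    (y : EuclideanSpace ℝ (Fin 3)) (hyz : y 2 = z₀) : v s y 2 = k * ((y 0 - c 0) ^ 2 + (y 1 - c 1) ^ 2) + m := by
  set π : EuclideanSpace ℝ (Fin 3) → EuclideanSpace ℝ (Fin 3) :=
    fun y' => y' + (z₀ - y' 2) • EuclideanSpace.single (2 : Fin 3) (1 : ℝ) with hπ
  have hπc : Continuous π := continuous_planeProj z₀
  have hA : AnalyticOnNhd ℝ (v s) univ := analyticOnNhd_slice hcont (bdd_of_hasTypeITimeDecay hrate) hmild hs
  have hF : AnalyticOnNhd ℝ (fun y' => v s (π y') 2) univ := fun y' _ =>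
    ((EuclideanSpace.proj (2 : Fin 3) : EuclideanSpace ℝ (Fin 3) →L[ℝ] ℝ).analyticAt _).comp
      ((hA (π y') (mem_univ _)).comp (analyticOnNhd_planeProj z₀ y' (mem_univ _)))
  have hQ : AnalyticOnNhd ℝ (fun y' : EuclideanSpace ℝ (Fin 3) => k * ((y' 0 - c 0) ^ 2 + (y' 1 - c 1) ^ 2) + m) univ :=
    ((contDiff_sqDist c).const_smul k |>.add contDiff_const).analyticOnNhd.mono (subset_univ _) |> fun h => by
      simpa [smul_eq_mul] using h
  have hO' : IsOpen (π ⁻¹' U) := hU.preimage hπc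
  have hne' : (π ⁻¹' U).Nonempty := by
    obtain ⟨y₀, hy₀, hy₀z⟩ := hne
    refine ⟨y₀, ?_⟩
    show π y₀ ∈ U
    rw [hπ]; dsimp only; rw [planeProj_eq_self hy₀z]; exact hy₀
  have h' : ∀ y' ∈ π ⁻¹' U, v s (π y') 2 = k * ((y' 0 - c 0) ^ 2 + (y' 1 - c 1) ^ 2) + m := by
    intro y' hy'
    have := h (π y') hy' (planeProj_apply y' z₀).2.2
    rw [(planeProj_apply y' z₀).1, (planeProj_apply y' z₀).2.1] at this
    exact this
  have hall := eq_of_eqOn_open hF hQ hO' hne' h' y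
  have hπy : π y = y := by rw [hπ]; dsimp only; rw [planeProj_eq_self hyz]
  rw [hπy] at hall
  exact hall

/-- **CLASS: a Hill-type quadratic vertical velocity on a planar open piece forces `k = 0`** — and then `v₂(s,·) ≡ m` on the whole plane
`{y₂ = z₀}`. -/
theorem quadratic_coeff_eq_zero_of_eqOn_plane (hrate : HasTypeITimeDecay C v)
    (hcont : ContinuousOn (uncurry v) (Iio (0 : ℝ) ×ˢ univ))
    (hmild : ∀ s t : ℝ, s < t → t < 0 → ∀ x,
      v t x = UnboundedOperators.heatExtension (v s) (t - s) x - oseenDuhamel 1 s v v t x)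
    {s : ℝ} (hs : s < 0) {k m : ℝ} {c : EuclideanSpace ℝ (Fin 3)} {z₀ : ℝ} {U : Set (EuclideanSpace ℝ (Fin 3))} (hU : IsOpen U)
    (hne : ∃ y ∈ U, y 2 = z₀) (h : ∀ y ∈ U, y 2 = z₀ → v s y 2 = k * ((y 0 - c 0) ^ 2 + (y 1 - c 1) ^ 2) + m) :
    k = 0 ∧ ∀ y : EuclideanSpace ℝ (Fin 3), y 2 = z₀ → v s y 2 = m := by
  set π : EuclideanSpace ℝ (Fin 3) → EuclideanSpace ℝ (Fin 3) :=
    fun y' => y' + (z₀ - y' 2) • EuclideanSpace.single (2 : Fin 3) (1 : ℝ) with hπ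
  have hall : ∀ y', v s (π y') 2 = k * ((y' 0 - c 0) ^ 2 + (y' 1 - c 1) ^ 2) + m := by
    intro y'
    have := apply_two_eq_quadratic_of_eqOn_plane hrate hcont hmild hs hU hne h (π y') (planeProj_apply y' z₀).2.2
    rw [(planeProj_apply y' z₀).1, (planeProj_apply y' z₀).2.1] at this
    exact this
  have hk : k = 0 := by
    by_contra hk
    apply not_bddAbove_quadratic hk c (m := m)
    refine ⟨C / Real.sqrt (-s), ?_⟩
    rintro _ ⟨y', rfl⟩
    have hcoord : |v s (π y') 2| ≤ ‖v s (π y')‖ :=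
      Summit.NavierStokesRegularity.NavierStokesRegularity.Theorems.PoloidalWindowDoorPoloidalWindowRigidityConstantShearMeans.abs_apply_le_norm
        (v s (π y')) 2
    have hb := hrate s hs (π y')
    dsimp only
    rw [← hall y']
    exact hcoord.trans hb
  refine ⟨hk, fun y' hy'z => ?_⟩
  have := apply_two_eq_quadratic_of_eqOn_plane hrate hcont hmild hs hU hne h y' hy'z
  simpa [hk] using this

/-- … hence the plane `{y₂ = z₀}` is horizontally FLAT: `∂_b v₂(s,y) = 0` for `b ≠ 2` at every point `y` of the plane (the non-degeneracy
clause `∇_h v₂ ≠ 0` of the registered stubs fails there). -/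
theorem horizontalGradient_eq_zero_of_quadratic_plane (hrate : HasTypeITimeDecay C v)
    (hcont : ContinuousOn (uncurry v) (Iio (0 : ℝ) ×ˢ univ))
    (hmild : ∀ s t : ℝ, s < t → t < 0 → ∀ x,
      v t x = UnboundedOperators.heatExtension (v s) (t - s) x - oseenDuhamel 1 s v v t x)
    {s : ℝ} (hs : s < 0) {k m : ℝ} {c : EuclideanSpace ℝ (Fin 3)} {z₀ : ℝ} {U : Set (EuclideanSpace ℝ (Fin 3))} (hU : IsOpen U)
    (hne : ∃ y ∈ U, y 2 = z₀) (h : ∀ y ∈ U, y 2 = z₀ → v s y 2 = k * ((y 0 - c 0) ^ 2 + (y 1 - c 1) ^ 2) + m)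
    {y : EuclideanSpace ℝ (Fin 3)} (hyz : y 2 = z₀) {b : Fin 3} (hb : b ≠ 2) :
    fderiv ℝ (v s) y (EuclideanSpace.single b 1) 2 = 0 := by
  obtain ⟨_, hall⟩ := quadratic_coeff_eq_zero_of_eqOn_plane hrate hcont hmild hs hU hne h
  have hA : AnalyticOnNhd ℝ (v s) univ := analyticOnNhd_slice hcont (bdd_of_hasTypeITimeDecay hrate) hmild hs
  have hd : DifferentiableAt ℝ (v s) y := (hA y (mem_univ y)).differentiableAt
  rw [← Summit.NavierStokesRegularity.NavierStokesRegularity.Theorems.PoloidalWindowDoorPoloidalWindowRigidityConstantShearMeans.fderiv_coord_apply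
    hd 2]
  have hd2 : DifferentiableAt ℝ (fun y' => v s y' 2) y :=
    ((EuclideanSpace.proj (2 : Fin 3) : EuclideanSpace ℝ (Fin 3) →L[ℝ] ℝ).differentiableAt).comp y hd
  have heq : ∀ᶠ y' in 𝓝 y, y' 2 = y 2 → (fun y'' => v s y'' 2) y' = (fun _ => m) y' := by
    filter_upwards with y' hy'
    exact hall y' (hy'.trans hyz)
  rw [fderiv_apply_eq_of_eqOn_plane_nhds hd2 (differentiableAt_const m) heq hb, fderiv_fun_const]
  rfl

end Class

end Summit.NavierStokesRegularity.NavierStokesRegularity.Theorems.PoloidalWindowDoorLrcModEntireAxisKinematics11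

end
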